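import Summits.Ventures.PercRepro.GenQSixFourFinal
import Summits.Ventures.PercRepro.GenQLevelThree
import Summits.Ventures.PercRepro.GenQHallNecessary
import Summits.Ventures.PercRepro.GenQOpenLayers

/-!
# PercRepro — the Hall form of C-025 (C-029) holds at `(5, 3)` and `(6, 4)` on the core, in the kernel
(night-4, gen 2)

`GenQTopWitness.lean` proves the rows `(q + 2, q)` on the core (simple, rank `≥ q + 2`, coloop-free at rank `q + 2`)
by the hard max-trace rule: the balances of the types `t ≤ q − 1` give the per-flat inequalities of
`PerFlat.c025_of_perFlat_normalized` on every rank-`q` flat.  This file EXPOSES that per-flat step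
(`perFlat_hard_of_flats`) and feeds it to `hall_of_hardRule` (`GenQHallNecessary.lean`): the Hall condition
`Hall M (q + 2) q (Φ(q + 2, q))` holds on every core matroid whose rank-`q` flats satisfy the balances at the types
`t ≤ q − 1` (`hall_core_of_flats`).  With the landed level-`3` theorem (`perFlatBelowFlat_three`) and the landed
`(6, 4)` balances (`J_zero_nonneg` … `typeThreeSmall_holds`, `twentyOnePrime_holds`):

* `hall_five_three_core`: `Hall M 5 3 (Φ(5, 3))` on every simple matroid of rank `≥ 5`, coloop-free at rank `5`;
* `hall_six_four_core`: `Hall M 6 4 (Φ(6, 4))` on every simple matroid of rank `≥ 6`, coloop-free at rank `6`;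

i.e. C-029 (RULING (rk)) at `(5, 3)` and `(6, 4)` on the core — every per-flat certificate proof of a row is a proof
of its Hall form there; and `hall_core_of_openLayers`: for `q ≥ 3`, the open layers of level `q` (`GenQOpenLayers`)
give `Hall M (q + 2) q (Φ(q + 2, q))` on the core, so C-029's conditional status on the diagonal is C-025's.
Imports `GenQSixFourFinal` (for `twentyOnePrime_holds`), `GenQLevelThree`, `GenQHallNecessary`, `GenQOpenLayers`.
-/

namespace PercRepro.GenQ

open Finset ThmH PerFlat SixFour

variable {α : Type*} [DecidableEq α] {M : Matroid α} [M.Finite]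

/-- **The per-flat inequalities of the hard max-trace rule on the core** from the balances of the types
`t ≤ q − 1` on the rank-`q` flats (the per-flat step of `rls_succ_succ_of_perFlatBelow`, exposed). -/
theorem perFlat_hard_of_flats (q : ℕ) (hq : 1 ≤ q) (hge : ((q + 2 : ℕ) : ℕ∞) ≤ M.eRank)
    (hcol : M.eRank = ((q + 2 : ℕ) : ℕ∞) → ∀ e, ¬ M.IsColoop e)
    (hbelow : ∀ G ∈ flatsQ M q, ∀ t, t + 1 ≤ q → 0 ≤ Jq M G q t) :
    ∀ G ∈ flatsQ M q, (((q : ℚ) + 2) / ((q : ℚ) + 1)) * ((UqG M (q + 2) q G).card : ℚ) ≤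
      ∑ S ∈ Yq M (q + 2) q, fHardQ M q G S / DHardQ M q S := by
  intro G hG
  have htq := typeOfQ_le_q hG hge
  by_cases htop : typeOfQ M q G = q
  · obtain ⟨h2, hR⟩ := eRk_sdiff_eq_two_of_typeOfQ_eq hq hG hge htop
    have h3 := three_le_card_sdiff_of_top (hcol hR) hR hG h2
    exact perFlat_of_Jq_nonneg' hG (t' := q - 1) (by omega) (by omega) (hbelow G hG (q - 1) (by omega))
  · exact perFlat_of_Jq_nonneg' hG le_rfl (sub_typeOfQ_le_card q G) (hbelow G hG _ (by omega))

/-- **The Hall condition on the core from the balances**: `Hall M (q + 2) q (Φ(q + 2, q))`. -/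
theorem hall_core_of_flats (q : ℕ) (hq : 1 ≤ q) (hge : ((q + 2 : ℕ) : ℕ∞) ≤ M.eRank)
    (hcol : M.eRank = ((q + 2 : ℕ) : ℕ∞) → ∀ e, ¬ M.IsColoop e)
    (hbelow : ∀ G ∈ flatsQ M q, ∀ t, t + 1 ≤ q → 0 ≤ Jq M G q t) :
    Hall M (q + 2) q (phiK (q + 2) q) := by
  rw [phiK_succ_succ]
  exact hall_of_hardRule (by positivity) (perFlat_hard_of_flats q hq hge hcol hbelow)

/-- **The Hall condition on the core from `PerFlatBelow q`** (the balances of the types `t ≤ q − 1` on every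
rank-`q` set of every simple matroid). -/
theorem hall_core_of_perFlatBelow {γ : Type} [DecidableEq γ] {M : Matroid γ} [M.Finite] (q : ℕ) (hq : 1 ≤ q)
    (hbelow : PerFlatBelow q) (hs : Simple M) (hge : ((q + 2 : ℕ) : ℕ∞) ≤ M.eRank)
    (hcol : M.eRank = ((q + 2 : ℕ) : ℕ∞) → ∀ e, ¬ M.IsColoop e) : Hall M (q + 2) q (phiK (q + 2) q) := by
  have hflats : ∀ G ∈ flatsQ M q, ∀ t, t + 1 ≤ q → 0 ≤ Jq M G q t := by
    intro G hG t ht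
    have hGg : G ⊆ gr M := (mem_flatsQ.1 hG).1
    have hr : M.eRk (G : Set γ) = (q : ℕ∞) := (mem_flatsQ.1 hG).2.2
    exact hbelow M G hs hGg hr t ht
  exact hall_core_of_flats q hq hge hcol hflats

/-- **C-029 at `(5, 3)` on the core**: `Hall M 5 3 (Φ(5, 3))` on every simple matroid of rank `≥ 5`, coloop-free at
rank `5` (level `3` is closed: `perFlatBelowFlat_three`). -/
theorem hall_five_three_core (hs : Simple M) (hge : (5 : ℕ∞) ≤ M.eRank)
    (hcol : M.eRank = 5 → ∀ e, ¬ M.IsColoop e) : Hall M 5 3 (phiK 5 3) := by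
  have h := hall_core_of_flats (M := M) 3 (by norm_num) (by exact_mod_cast hge)
    (fun h => hcol (by exact_mod_cast h)) (fun G hG t ht => perFlatBelowFlat_three hs hG t ht)
  exact h

/-- The `(6, 4)` balances of the types `t ≤ 3` on every rank-`4` set of a simple matroid (the landed `SixFourT1` and
the two type-`3` pieces of record). -/
theorem perFlatBelow_four : PerFlatBelow 4 := by
  intro β _ M _ G hs hG hr t ht
  rw [Jq_four]
  have hr' : M.eRk (G : Set β) = 4 := by rw [hr]; rfl
  rcases (show t = 0 ∨ t = 1 ∨ t = 2 ∨ t = 3 by omega) with rfl | rfl | rfl | rfl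
  · exact J_zero_nonneg hs hG
  · exact J_one_nonneg hs hG hr'
  · exact J_two_nonneg hs hG hr'
  · by_cases hg : 10 ≤ G.card
    · exact twentyOnePrime_holds M G hs hG hr' hg
    · exact typeThreeSmall_holds M G hs hG hr' (by omega)

/-- **C-029 at `(6, 4)` on the core**: `Hall M 6 4 (Φ(6, 4))` on every simple matroid of rank `≥ 6`, coloop-free at
rank `6`. -/
theorem hall_six_four_core {γ : Type} [DecidableEq γ] {M : Matroid γ} [M.Finite] (hs : Simple M)
    (hge : (6 : ℕ∞) ≤ M.eRank) (hcol : M.eRank = 6 → ∀ e, ¬ M.IsColoop e) : Hall M 6 4 (phiK 6 4) := by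
  have h := hall_core_of_perFlatBelow (M := M) 4 (by norm_num) perFlatBelow_four hs (by exact_mod_cast hge)
    (fun h => hcol (by exact_mod_cast h))
  exact h

/-- **The Hall condition on the core from the open layers of level `q`** (`q ≥ 3`): the residue on `𝔉_q` plus the
dichotomy off `𝔉_q` give the balances on every rank-`q` flat. -/
theorem hall_core_of_openLayers {γ : Type} [DecidableEq γ] {M : Matroid γ} [M.Finite] (q : ℕ) (hq : 3 ≤ q)
    (h : OpenLayers q) (hs : Simple M) (hge : ((q + 2 : ℕ) : ℕ∞) ≤ M.eRank)
    (hcol : M.eRank = ((q + 2 : ℕ) : ℕ∞) → ∀ e, ¬ M.IsColoop e) : Hall M (q + 2) q (phiK (q + 2) q) := by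
  have hres : PerFlatResidueBelowFlat q := perFlatResidueBelowFlat_of_openLayers (by omega) h
  have hflats : ∀ G ∈ flatsQ M q, ∀ t, t + 1 ≤ q → 0 ≤ Jq M G q t := by
    intro G hG t ht
    by_cases hF : TwoHyp M G q
    · exact hres M G hs hG hF t ht
    · exact Jq_nonneg_of_not_twoHyp (mem_flatsQ.1 hG).1 (mem_flatsQ.1 hG).2.2 hF (by omega)
  exact hall_core_of_flats q (by omega) hge hcol hflats

end PercRepro.GenQ
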